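import Mathlib
import Summits.ValiantsHypothesis.ValiantsHypothesis.Theses.ValuativeGCT
import Literature.NumberTheory.DiophantineGeometry.GLHighestWeightMultiplicityProofs
import Literature.NumberTheory.DiophantineGeometry.GLHighestWeightIsomorphismProofs
import Literature.NumberTheory.DiophantineGeometry.GLHighestWeightExistsUniqueProofs
import Literature.NumberTheory.DiophantineGeometry.GLPolynomialRepSemisimpleProofs
import Literature.Computability.AlgebraicComplexity.MultiplicityObstructionsProofs
/-!
# Counting lemma for rational GL-modules (B4)

Stub `stub_multiplicityCount` of line `skew-restriction-rank` for crux `ValuativeGCT.ValuativeFlip`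
(stmt-ValiantsHypothesis-12624), bottom-of-the-window decomposition (second lead, 2026-08-16).

For two finite-dimensional rational representations `ρ, ρ'` of `GL σ ℂ` on `V, V'` with
`dim V' < dim V` there is a weight `χ` with `hwMultiplicity ρ' χ < hwMultiplicity ρ χ`.
We prove the contrapositive, "`hwMultiplicity ρ χ ≤ hwMultiplicity ρ' χ` for all `χ` forces
`dim V ≤ dim V'`", by induction on `dim V`: a nonzero `V` has a highest-weight vector `v`
(Lie–Kolchin, `exists_hasHighestWeight_of_finiteDimensional_holds`); the stable subspace
`U = span (G · v)` is irreducible (`isIrreducible_toRepresentation_span_orbit`, complete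
reducibility `isSemisimpleRepresentation_of_isRationalRep_holds`) and embeds into `V'`
(`exists_intertwiningMap_apply_eq` + Schur); stable complements `V = U ⊕ C`, `V' = U' ⊕ C'`
(`U' ≅ U` the image) and additivity of `hwMultiplicity` over stable direct sums reduce to
`dim C < dim V`.

References: R. Goodman, N. Wallach, *Symmetry, Representations, and Invariants*, GTM 255 (2009),
§4.1.6, Thm. 4.2.12 (isotypic decomposition and multiplicities). [GoodmanWallachGTM255]
-/

set_option linter.dupNamespace false

namespace Summit.ValiantsHypothesis.ValiantsHypothesis.Theorems.ValuativeFlip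

open MvPolynomial
open scoped BigOperators Matrix
open Literature.NumberTheory.DiophantineGeometry
open Literature.Computability.AlgebraicComplexity

noncomputable section

section MultiplicityCountAux

variable {σ : Type} [Fintype σ] [LinearOrder σ]
variable {V : Type} [AddCommGroup V] [Module ℂ V]

/-- The highest-weight vectors of weight `χ` of a subrepresentation `U ⊆ V`, viewed in `V`, are
the highest-weight vectors of `V` of weight `χ` lying in `U`. Goodman–Wallach §3.2.1. [folklore] -/
theorem mc_map_highestWeightSpace_toRepresentation {ρ : Representation ℂ (GL σ ℂ) V}
    (U : Subrepresentation ρ) (χ : Weight σ) :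
    (highestWeightSpace U.toRepresentation χ).map U.toSubmodule.subtype =
      highestWeightSpace ρ χ ⊓ U.toSubmodule := by
  ext x
  constructor
  · rintro ⟨y, hy, rfl⟩
    exact ⟨(mem_highestWeightSpace_toRepresentation_iff U χ y).mp hy, y.2⟩
  · rintro ⟨hx, hxU⟩
    exact ⟨⟨x, hxU⟩, (mem_highestWeightSpace_toRepresentation_iff U χ ⟨x, hxU⟩).mpr hx, rfl⟩

/-- The multiplicity of `χ` in a subrepresentation `U ⊆ V` is the dimension of the space of
highest-weight vectors of `V` of weight `χ` lying in `U`. Goodman–Wallach §4.1.6. [folklore] -/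
theorem mc_hwMultiplicity_toRepresentation {ρ : Representation ℂ (GL σ ℂ) V}
    (U : Subrepresentation ρ) (χ : Weight σ) :
    hwMultiplicity U.toRepresentation χ =
      Module.finrank ℂ ↥(highestWeightSpace ρ χ ⊓ U.toSubmodule) := by
  rw [hwMultiplicity, ← mc_map_highestWeightSpace_toRepresentation U χ,
    Submodule.finrank_map_subtype_eq]

/-- Complementary subrepresentations have complementary underlying submodules. [folklore] -/
theorem mc_isCompl_toSubmodule {ρ : Representation ℂ (GL σ ℂ) V} {U C : Subrepresentation ρ}
    (h : IsCompl U C) : IsCompl U.toSubmodule C.toSubmodule :=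
  ⟨by rw [disjoint_iff]; exact congrArg Subrepresentation.toSubmodule h.disjoint.eq_bot,
   by rw [codisjoint_iff]; exact congrArg Subrepresentation.toSubmodule h.codisjoint.eq_top⟩

/-- **Additivity of multiplicities over a stable direct sum.** If `V = U ⊕ C` with `U, C` stable,
then `hwMultiplicity ρ χ = hwMultiplicity ρ|_U χ + hwMultiplicity ρ|_C χ`: the components of a
highest-weight vector along the decomposition are highest-weight vectors of the same weight
(`mem_highestWeightSpace_of_isCompl`). Goodman–Wallach §4.1.6 with Thm. 4.2.12. [folklore] -/
theorem mc_hwMultiplicity_add_of_isCompl [FiniteDimensional ℂ V]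
    {ρ : Representation ℂ (GL σ ℂ) V} {U C : Subrepresentation ρ} (h : IsCompl U C)
    (χ : Weight σ) :
    hwMultiplicity U.toRepresentation χ + hwMultiplicity C.toRepresentation χ =
      hwMultiplicity ρ χ := by
  have hUC : IsCompl U.toSubmodule C.toSubmodule := mc_isCompl_toSubmodule h
  have hinf : highestWeightSpace ρ χ ⊓ U.toSubmodule ⊓ (highestWeightSpace ρ χ ⊓ C.toSubmodule)
      = ⊥ :=
    (hUC.disjoint.mono inf_le_right inf_le_right).eq_bot
  have hsup : highestWeightSpace ρ χ ⊓ U.toSubmodule ⊔ highestWeightSpace ρ χ ⊓ C.toSubmodule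
      = highestWeightSpace ρ χ := by
    refine le_antisymm (sup_le inf_le_left inf_le_left) fun v hv => ?_
    have hvtop : v ∈ U.toSubmodule ⊔ C.toSubmodule := by
      rw [hUC.sup_eq_top]
      exact Submodule.mem_top
    obtain ⟨u, hu, c, hc, rfl⟩ := Submodule.mem_sup.mp hvtop
    have hu' : u ∈ highestWeightSpace ρ χ := mem_highestWeightSpace_of_isCompl h hu hc hv
    have hc' : c ∈ highestWeightSpace ρ χ := by
      refine mem_highestWeightSpace_of_isCompl h.symm hc hu ?_
      rwa [add_comm]
    exact Submodule.mem_sup.mpr ⟨u, ⟨hu', hu⟩, c, ⟨hc', hc⟩, rfl⟩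
  rw [mc_hwMultiplicity_toRepresentation U χ, mc_hwMultiplicity_toRepresentation C χ,
    ← Submodule.finrank_sup_add_finrank_inf_eq, hinf, hsup, finrank_bot, add_zero,
    hwMultiplicity]

/-- **Peeling off an irreducible.** For finite-dimensional rational representations `ρ, ρ'` of
`GL σ ℂ` with `hwMultiplicity ρ χ ≤ hwMultiplicity ρ' χ` for every weight `χ`, one has
`dim V ≤ dim V'`; by induction on `dim V` (statement for all `V` of dimension `≤ n`): split off
the irreducible stable subspace generated by a highest-weight vector of `V`, embed it into `V'`
by an intertwiner (theorem of the highest weight + Schur), and pass to stable complements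
(complete reducibility), over which multiplicities are additive.
Goodman–Wallach §4.1.6, Thm. 4.2.12. [folklore] -/
theorem mc_finrank_le_of_forall_hwMultiplicity_le (n : ℕ) :
    ∀ (V : Type) [AddCommGroup V] [Module ℂ V] [FiniteDimensional ℂ V]
      (V' : Type) [AddCommGroup V'] [Module ℂ V'] [FiniteDimensional ℂ V']
      (ρ : Representation ℂ (GL σ ℂ) V) (ρ' : Representation ℂ (GL σ ℂ) V'),
      IsRationalRep ρ → IsRationalRep ρ' → Module.finrank ℂ V ≤ n →
      (∀ χ : Weight σ, hwMultiplicity ρ χ ≤ hwMultiplicity ρ' χ) →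
      Module.finrank ℂ V ≤ Module.finrank ℂ V' := by
  induction n with
  | zero =>
    intro V _ _ _ V' _ _ _ ρ ρ' _ _ hn _
    exact hn.trans (Nat.zero_le _)
  | succ n ih =>
    intro V _ _ _ V' _ _ _ ρ ρ' hρ hρ' hn hle
    by_cases hV : Module.finrank ℂ V = 0
    · rw [hV]
      exact Nat.zero_le _
    haveI : Nontrivial V := Module.nontrivial_of_finrank_pos (Nat.pos_of_ne_zero hV)
    -- a highest-weight vector `v` of `V`
    obtain ⟨χ₀, hχ₀⟩ := exists_hasHighestWeight_of_finiteDimensional_holds ρ hρ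
    obtain ⟨v, hv0, hv⟩ := (hasHighestWeight_iff_exists ρ χ₀).mp hχ₀
    -- the irreducible stable subspace `U = span (G · v)`
    let U : Subrepresentation ρ :=
      ⟨Submodule.span ℂ (Set.range fun g : GL σ ℂ => ρ g v),
        fun g _ hy => apply_mem_span_orbit ρ v g hy⟩
    have hU : U.toSubmodule = Submodule.span ℂ (Set.range fun g : GL σ ℂ => ρ g v) := rfl
    have hss : ρ.IsSemisimpleRepresentation :=
      isSemisimpleRepresentation_of_isRationalRep_holds hρ
    have hss' : ρ'.IsSemisimpleRepresentation :=
      isSemisimpleRepresentation_of_isRationalRep_holds hρ'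
    haveI : U.toRepresentation.IsIrreducible :=
      isIrreducible_toRepresentation_span_orbit hρ hss hv hv0 U hU
    have hUrat : IsRationalRep U.toRepresentation := hρ.toRepresentation U
    have hvU : v ∈ U.toSubmodule :=
      Submodule.subset_span ⟨1, show ρ 1 v = v by rw [map_one, Module.End.one_apply]⟩
    set x : U.toSubmodule := ⟨v, hvU⟩
    have hx : x ∈ highestWeightSpace U.toRepresentation χ₀ :=
      (mem_highestWeightSpace_toRepresentation_iff U χ₀ x).mpr hv
    have hx0 : x ≠ 0 := fun h => hv0 (congrArg Subtype.val h)
    -- a highest-weight vector `v'` of `V'` of the same weight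
    have hmult' : hwMultiplicity ρ' χ₀ ≠ 0 := by
      have h1 := (hasHighestWeight_iff_hwMultiplicity_ne_zero ρ χ₀).mp hχ₀
      have h2 := hle χ₀
      omega
    obtain ⟨v', hv'0, hv'⟩ := (hasHighestWeight_iff_exists ρ' χ₀).mp
      ((hasHighestWeight_iff_hwMultiplicity_ne_zero ρ' χ₀).mpr hmult')
    -- an injective intertwiner `f : U → V'` with `f x = v'`
    obtain ⟨f, hf⟩ := exists_intertwiningMap_apply_eq hUrat hx hx0 hρ' hv' hv'0
    have hfinj : Function.Injective f := by
      rcases Representation.IsIrreducible.injective_or_eq_zero f with h | h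
      · exact h
      · exfalso
        apply hv'0
        rw [← hf, h]
        rfl
    -- its image `U' ≅ U`
    let U' : Subrepresentation ρ' := f.range
    have hres_inj : Function.Injective (intertwiningRangeRestrict f) :=
      fun a b hab => hfinj (congrArg Subtype.val hab)
    let e : U.toRepresentation.Equiv U'.toRepresentation :=
      (intertwiningRangeRestrict f).ofBijective ⟨hres_inj, intertwiningRangeRestrict_surjective f⟩
    -- stable complements
    obtain ⟨C, hC⟩ := exists_isCompl U
    obtain ⟨C', hC'⟩ := exists_isCompl U'
    have hdimV := Submodule.finrank_add_eq_of_isCompl (mc_isCompl_toSubmodule hC)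
    have hdimV' := Submodule.finrank_add_eq_of_isCompl (mc_isCompl_toSubmodule hC')
    have hdimU : Module.finrank ℂ U.toSubmodule = Module.finrank ℂ U'.toSubmodule :=
      e.toLinearEquiv.finrank_eq
    have hUpos : Module.finrank ℂ U.toSubmodule ≠ 0 := by
      rw [Ne, Submodule.finrank_eq_zero]
      intro hbot
      apply hv0
      have : v ∈ (⊥ : Submodule ℂ V) := hbot ▸ hvU
      exact (Submodule.mem_bot ℂ).mp this
    have hCn : Module.finrank ℂ C.toSubmodule ≤ n := by omega
    have hmultC : ∀ χ : Weight σ,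
        hwMultiplicity C.toRepresentation χ ≤ hwMultiplicity C'.toRepresentation χ := by
      intro χ
      have h1 := mc_hwMultiplicity_add_of_isCompl hC χ
      have h2 := mc_hwMultiplicity_add_of_isCompl hC' χ
      have h3 := hwMultiplicity_congr e χ
      have h4 := hle χ
      omega
    have hIH := ih _ _ C.toRepresentation C'.toRepresentation (hρ.toRepresentation C)
      (hρ'.toRepresentation C') hCn hmultC
    omega

end MultiplicityCountAux

/-- **Counting lemma (B4).** For finite-dimensional rational representations `ρ, ρ'` of
`GL σ ℂ` on `V, V'` with `dim V' < dim V`, some highest weight `χ` has strictly smaller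
multiplicity in `ρ'` than in `ρ`: otherwise `hwMultiplicity ρ χ ≤ hwMultiplicity ρ' χ` for all
`χ`, and peeling off irreducibles (complete reducibility of rational `GL`-modules,
`isSemisimpleRepresentation_of_isRationalRep_holds`; theorem of the highest weight,
`exists_intertwiningMap_apply_eq`; Lie–Kolchin, `exists_hasHighestWeight_of_finiteDimensional_holds`)
gives `dim V ≤ dim V'` (`mc_finrank_le_of_forall_hwMultiplicity_le`). Equivalently
`dim V = ∑_χ hwMultiplicity ρ χ · dim V(χ)` is monotone in the multiplicities.
Goodman–Wallach, *Symmetry, Representations, and Invariants*, §4.1.6 with Thm. 4.2.12. [folklore] -/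
theorem stub_multiplicityCount (σ : Type) [Fintype σ] [LinearOrder σ]
    (V : Type) [AddCommGroup V] [Module ℂ V] [FiniteDimensional ℂ V]
    (V' : Type) [AddCommGroup V'] [Module ℂ V'] [FiniteDimensional ℂ V']
    (ρ : Representation ℂ (GL σ ℂ) V) (ρ' : Representation ℂ (GL σ ℂ) V')
    (hρ : IsRationalRep ρ) (hρ' : IsRationalRep ρ')
    (h : Module.finrank ℂ V' < Module.finrank ℂ V) :
    ∃ χ : Weight σ, hwMultiplicity ρ' χ < hwMultiplicity ρ χ := by
  by_contra hcon
  refine absurd (mc_finrank_le_of_forall_hwMultiplicity_le (Module.finrank ℂ V) V V' ρ ρ' hρ hρ'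
    le_rfl fun χ => ?_) (not_le.mpr h)
  exact not_lt.mp fun hχ => hcon ⟨χ, hχ⟩


end

end Summit.ValiantsHypothesis.ValiantsHypothesis.Theorems.ValuativeFlip
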